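import Mathlib
import Summits.MatrixMultiplication.MatrixMultiplication.Theorems.GradedDesignFamily.Negative.GridLaw

/-!
# The fibre law: row-plus-column structure of periodised frame functions on a grid, and the path obstruction
# (crux `LevelGradedCohnUmans.GradedDesignFamily`, stmt-MatrixMultiplication-7610; negative side,
# line `quadratic-extension-level-one-cell`, lead c6)

Abstract form of §1–2 of `Cruxes/GradedDesignFamily/Lines/quadratic-extension-level-one-cell-c6.md`.
Let `G` act on a finite set `V`, `H ≤ G` finite, and let `Γ ⊆ G` carry two labels `ρ : G → R` ("row") and
`κ : G → K` ("column") and a predicate `p` on `V` such that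

* elements of `Γ` with the same row move every `v` with `¬ p v` to the same `H`-orbit point
  (`ρ n = ρ n' → ∃ h ∈ H, n' • v = h • n • v`), and
* elements of `Γ` with the same column do so for every `v` with `p v`.

(In the level-one subfield cell: `Γ = N_G(H) = GL₂(k)K^×`, `p` = "isotropic / rank one", `ρ` = the class in
`K^×/k^×`, `κ` = the `k`-determinant class; the grid `Γ/H ≅ (q+1) × (q−1)`.)  Then:

* `sum_frame_rowcol` — for every frame function `F = Σ_u C u (· • u)` and every `g`, the periodised values
  `S(n) := Σ_{h ∈ H} F(h n g)` (`n ∈ Γ`) have the form `P(ρ n) + Q(κ n)`: ROW FUNCTION PLUS COLUMN FUNCTION.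
* `not_frameSeparated_of_fibre_path` — consequently, under route separation with first set `H`, for no target
  `z₀` can the garbage words in the grid `Γ z₀` contain an alternating path
  `e₀, e₁, …, e_{2k} ∈ Γ` from the row of `1` to the column of `1`
  (`ρ e₀ = ρ 1`, `κ e_{2j} = κ e_{2j+1}`, `ρ e_{2j+1} = ρ e_{2j+2}`, `κ e_{2k} = κ 1`):
  telescoping `P` along the path gives `S(1) = S(e_{2k}) = 0`, while the target forces `S(1) = 1`.
  The landed grid law (`GridLaw.lean`) is the 4-cycle instance; connectivity of the garbage graph between the
  target's row and column is the general obstruction ("fibre law").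

Sorry-free; axioms `propext`, `Classical.choice`, `Quot.sound`.
-/

set_option linter.dupNamespace false

noncomputable section

open scoped BigOperators

namespace Summit.MatrixMultiplication.MatrixMultiplication.Theorems.GradedDesignFamily.Negative

/-- Orbit sums are constant along `H`-orbits: `Σ_h φ(h h₀ • w) = Σ_h φ(h • w)` for `h₀ ∈ H`. -/
theorem sum_subgroup_smul_orbit {G V : Type} [Group G] [MulAction G V] (H : Subgroup G) [Fintype H]
    (φ : V → ℂ) (w : V) {h₀ : G} (hh₀ : h₀ ∈ H) :
    ∑ h : H, φ (((h : G) * h₀) • w) = ∑ h : H, φ ((h : G) • w) :=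
  sum_subgroup_mul_right H (fun x : G => φ (x • w)) hh₀

/-- **Row-plus-column structure.**  Under the two orbit hypotheses, the `H`-periodised values of any frame
function along `Γ·g` decompose as a function of the row label plus a function of the column label. -/
theorem sum_frame_rowcol {G V : Type} [Group G] [MulAction G V] [Fintype V]
    (H : Subgroup G) [Fintype H] {R K : Type} (Γ : Set G) (ρ : G → R) (κ : G → K) (p : V → Prop)
    (hρ : ∀ n ∈ Γ, ∀ n' ∈ Γ, ρ n = ρ n' → ∀ v : V, ¬ p v → ∃ h ∈ H, n' • v = h • n • v)
    (hκ : ∀ n ∈ Γ, ∀ n' ∈ Γ, κ n = κ n' → ∀ v : V, p v → ∃ h ∈ H, n' • v = h • n • v)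
    (C : V → V → ℂ) (g : G) :
    ∃ P : R → ℂ, ∃ Q : K → ℂ, ∀ n ∈ Γ,
      ∑ h : H, (∑ u, C u (((h : G) * n * g) • u)) = P (ρ n) + Q (κ n) := by
  classical
  -- orbit sums
  set σ : V → V → ℂ := fun u w => ∑ h : H, C u ((h : G) • w) with hσ
  have hS : ∀ n : G, ∑ h : H, (∑ u, C u (((h : G) * n * g) • u)) = ∑ u, σ u ((n * g) • u) := by
    intro n
    rw [Finset.sum_comm]
    refine Finset.sum_congr rfl (fun u _ => ?_)
    simp only [hσ, mul_smul]
  -- the two partial sums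
  let SP : G → ℂ := fun n => ∑ u ∈ Finset.univ.filter (fun u => ¬ p (g • u)), σ u ((n * g) • u)
  let SQ : G → ℂ := fun n => ∑ u ∈ Finset.univ.filter (fun u => p (g • u)), σ u ((n * g) • u)
  have hsplit : ∀ n : G, ∑ u, σ u ((n * g) • u) = SP n + SQ n := by
    intro n
    simp only [SP, SQ]
    rw [add_comm]
    exact (Finset.sum_filter_add_sum_filter_not Finset.univ (fun u => p (g • u)) _).symm
  -- `SP` depends only on the row, `SQ` only on the column (inside `Γ`)
  have hP : ∀ n ∈ Γ, ∀ n' ∈ Γ, ρ n = ρ n' → SP n' = SP n := by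
    intro n hn n' hn' hr
    refine Finset.sum_congr rfl (fun u hu => ?_)
    have hpu : ¬ p (g • u) := (Finset.mem_filter.1 hu).2
    obtain ⟨h₀, hh₀, heq⟩ := hρ n hn n' hn' hr (g • u) hpu
    have e1 : (n' * g) • u = h₀ • ((n * g) • u) := by rw [mul_smul, heq, mul_smul]
    have key := sum_subgroup_smul_orbit H (C u) ((n * g) • u) hh₀
    simpa only [hσ, e1, mul_smul] using key
  have hQ : ∀ n ∈ Γ, ∀ n' ∈ Γ, κ n = κ n' → SQ n' = SQ n := by
    intro n hn n' hn' hc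
    refine Finset.sum_congr rfl (fun u hu => ?_)
    have hpu : p (g • u) := (Finset.mem_filter.1 hu).2
    obtain ⟨h₀, hh₀, heq⟩ := hκ n hn n' hn' hc (g • u) hpu
    have e1 : (n' * g) • u = h₀ • ((n * g) • u) := by rw [mul_smul, heq, mul_smul]
    have key := sum_subgroup_smul_orbit H (C u) ((n * g) • u) hh₀
    simpa only [hσ, e1, mul_smul] using key
  -- choose representatives of rows / columns met by `Γ`
  let P : R → ℂ := fun r => if hr : ∃ n ∈ Γ, ρ n = r then SP (Classical.choose hr) else 0
  let Q : K → ℂ := fun c => if hc : ∃ n ∈ Γ, κ n = c then SQ (Classical.choose hc) else 0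
  refine ⟨P, Q, fun n hn => ?_⟩
  have hr : ∃ m ∈ Γ, ρ m = ρ n := ⟨n, hn, rfl⟩
  have hc : ∃ m ∈ Γ, κ m = κ n := ⟨n, hn, rfl⟩
  have hPn : P (ρ n) = SP n := by
    simp only [P, dif_pos hr]
    obtain ⟨hm, hmr⟩ := Classical.choose_spec hr
    exact (hP _ hm n hn hmr).symm ▸ rfl
  have hQn : Q (κ n) = SQ n := by
    simp only [Q, dif_pos hc]
    obtain ⟨hm, hmc⟩ := Classical.choose_spec hc
    exact (hQ _ hm n hn hmc).symm ▸ rfl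
  rw [hS, hsplit, hPn, hQn]

/-- **The fibre law (path obstruction).**  Under route separation with first set the subgroup `H` and a test
space of frame functions, let `Γ, ρ, κ, p` be as in `sum_frame_rowcol` with `1 ∈ Γ`.  Then for no target
`z₀ ∈ Z` do the non-target words `x⁻¹ y y'⁻¹ z` cover `H`-cosets `H e₀ z₀, …, H e_{2k} z₀` (`eᵢ ∈ Γ`) forming an
alternating path from the row of `1` to the column of `1`:
`ρ e₀ = ρ 1`, `κ e_{2j} = κ e_{2j+1}`, `ρ e_{2j+1} = ρ e_{2j+2}` (`j < k`), `κ e_{2k} = κ 1`. -/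
theorem not_frameSeparated_of_fibre_path {G V : Type} [Group G] [MulAction G V] [Fintype V]
    [DecidableEq G] (H : Subgroup G) [Fintype H]
    (J : Submodule ℂ (G → ℂ)) (hJ : ∀ f ∈ J, ∃ C : V → V → ℂ, f = fun g => ∑ u, C u (g • u))
    {R K : Type} (Γ : Set G) (ρ : G → R) (κ : G → K) (p : V → Prop) (h1 : (1 : G) ∈ Γ)
    (hρ : ∀ n ∈ Γ, ∀ n' ∈ Γ, ρ n = ρ n' → ∀ v : V, ¬ p v → ∃ h ∈ H, n' • v = h • n • v)
    (hκ : ∀ n ∈ Γ, ∀ n' ∈ Γ, κ n = κ n' → ∀ v : V, p v → ∃ h ∈ H, n' • v = h • n • v)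
    (X Y Z : Finset G) (hX : ∀ x : G, x ∈ X ↔ x ∈ H)
    (hsep : ∀ x₀ ∈ X, ∀ z₀ ∈ Z, ∃ f ∈ J, ∀ x ∈ X, ∀ y ∈ Y, ∀ y' ∈ Y, ∀ z ∈ Z,
      (x = x₀ ∧ y = y' ∧ z = z₀ → f (x⁻¹ * y * y'⁻¹ * z) = 1) ∧
      (¬ (x = x₀ ∧ y = y' ∧ z = z₀) → f (x⁻¹ * y * y'⁻¹ * z) = 0))
    (z₀ : G) (hz₀ : z₀ ∈ Z) (k : ℕ) (e : ℕ → G) (he : ∀ i ≤ 2 * k, e i ∈ Γ)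
    (hrow : ρ (e 0) = ρ 1) (hcol : κ (e (2 * k)) = κ 1)
    (heven : ∀ j < k, κ (e (2 * j)) = κ (e (2 * j + 1)))
    (hodd : ∀ j < k, ρ (e (2 * j + 1)) = ρ (e (2 * j + 2)))
    (hgarb : ∀ i ≤ 2 * k, ∀ h : G, h ∈ H →
      ∃ x ∈ X, ∃ y ∈ Y, ∃ y' ∈ Y, ∃ z ∈ Z,
        ¬ (x = 1 ∧ y = y' ∧ z = z₀) ∧ h * e i * z₀ = x⁻¹ * y * y'⁻¹ * z) :
    False := by
  classical
  have h1X : (1 : G) ∈ X := (hX 1).2 H.one_mem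
  obtain ⟨f, hfJ, hf⟩ := hsep 1 h1X z₀ hz₀
  obtain ⟨C, rfl⟩ := hJ f hfJ
  obtain ⟨P, Q, hPQ⟩ := sum_frame_rowcol H Γ ρ κ p hρ hκ C z₀
  -- `Y` is non-empty
  obtain ⟨_, _, y₁, hy₁, -⟩ := hgarb 0 (Nat.zero_le _) 1 H.one_mem
  -- periodised value on the target coset: 1
  have htarget : ∑ h : H, (∑ u, C u (((h : G) * 1 * z₀) • u)) = 1 := by
    have hterm : ∀ h : H, (∑ u, C u (((h : G) * 1 * z₀) • u)) = if (h : G) = 1 then 1 else 0 := by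
      intro h
      have hxX : ((h : G)⁻¹) ∈ X := (hX _).2 (H.inv_mem h.2)
      obtain ⟨hone, hzero⟩ := hf ((h : G)⁻¹) hxX y₁ hy₁ y₁ hy₁ z₀ hz₀
      have hw : ((h : G)⁻¹)⁻¹ * y₁ * y₁⁻¹ * z₀ = (h : G) * 1 * z₀ := by group
      rw [hw] at hone hzero
      split_ifs with hh
      · exact hone ⟨inv_eq_one.2 hh, rfl, rfl⟩
      · exact hzero (fun hc => hh (inv_eq_one.1 hc.1))
    simp only [hterm, OneMemClass.coe_eq_one, Finset.sum_ite_eq', Finset.mem_univ, if_true]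
  -- periodised value on each path coset: 0
  have hpath : ∀ i ≤ 2 * k, ∑ h : H, (∑ u, C u (((h : G) * e i * z₀) • u)) = 0 := by
    intro i hi
    refine Finset.sum_eq_zero (fun h _ => ?_)
    obtain ⟨x, hx, y, hy, y', hy', z, hz, hnd, heq⟩ := hgarb i hi h h.2
    obtain ⟨-, hzero⟩ := hf x hx y hy y' hy' z hz
    have := hzero hnd
    rwa [← heq] at this
  -- translate to `P`, `Q`
  have hS1 : P (ρ 1) + Q (κ 1) = 1 := by rw [← hPQ 1 h1]; exact htarget
  have hSe : ∀ i ≤ 2 * k, P (ρ (e i)) + Q (κ (e i)) = 0 := by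
    intro i hi
    rw [← hPQ (e i) (he i hi)]
    exact hpath i hi
  -- telescope along the path: `P (ρ (e (2j))) = P (ρ 1)` for all `j ≤ k`
  have htel : ∀ j ≤ k, P (ρ (e (2 * j))) = P (ρ 1) := by
    intro j
    induction j with
    | zero => intro _; simp only [Nat.mul_zero, hrow]
    | succ j ih =>
      intro hj
      have hj' : j < k := Nat.lt_of_succ_le hj
      have ih' := ih (Nat.le_of_lt hj')
      have h2j : 2 * j ≤ 2 * k := by omega
      have h2j1 : 2 * j + 1 ≤ 2 * k := by omega
      have hA := hSe (2 * j) h2j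
      have hB := hSe (2 * j + 1) h2j1
      rw [heven j hj'] at hA
      -- `P (ρ (e (2j))) = P (ρ (e (2j+1)))`
      have hPP : P (ρ (e (2 * j + 1))) = P (ρ (e (2 * j))) := by linear_combination hB - hA
      have hidx : 2 * (j + 1) = 2 * j + 2 := by ring
      rw [hidx, ← hodd j hj', hPP, ih']
  have hlast := htel k le_rfl
  have hend := hSe (2 * k) le_rfl
  rw [hlast, hcol] at hend
  rw [hend] at hS1
  exact zero_ne_one hS1

end Summit.MatrixMultiplication.MatrixMultiplication.Theorems.GradedDesignFamily.Negative
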